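import Literature.MathematicalPhysics.QuantumFieldTheory.Balaban1983to89.T3LogComparisonSocket
import HarnessLib

/-!
# Route `UnitScaleTilt` — crux K1bR-pr `FluctuationComparisonRegPr` (stmt-QuantumFields-19201), stub `stub_logComparisonRegPr`,
# layer S-F «SOCKET»: (R1) two-sided representation ∧ (R2) Pint cut-off-Cauchy ⇒ the registered stub text VERBATIM
# (support file `--supports stmt-QuantumFields-19201`; the stub stays open)

Fleet lead `ym-ust-19201-p2` (gen 0); split card `CARD-19201-logComparison-split.md` (evidence #16), sub-lemma S-F = the route owner's (R3) of
`K1ii-OWNER-BRIEF-logComparisonRegPr.md` (evidence #17) and ruling 2026-08-26T12:55:11Z (B)(ii)–(iii): «land S-F in schema form with the shared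
explicit arguments; then, on a located request, v4 of 19201 = stub 3 → {S-D(K)∧S-D(K+1) socket, S-E} composed by S-F».  The two sockets are the
Literature schemas `T3LogComparisonSocket.TwoSidedRepAt` ([Balaban1985UV3] (41) ∧ (47) at the trivial history, pinned, interaction data `Pint`,
`E`, `Rm` as ARGUMENTS) and `T3LogComparisonSocket.PintCauchyAt` ([King1986] Thm 3.4 shape for the SAME `Pint`).  THIS FILE is the real analysis:

**`logComparisonRegPr_of_rep_of_cauchy`**: for any families of data `Pint F γ ε₀ b₀ p₀`, `E …`, `Rm …`, (∀-prefixed as the stub) `TwoSidedRepAt` ∧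
`PintCauchyAt` ⇒ the registered 888-character text of `stub_logComparisonRegPr` token for token, with `κ_K := c_K − E (K+1) n + E K n`,
`r_K := Rm (K+1) n + Rm K n + r′_K` (`n = ⌊K/m⌋`), `ε₁ := min`, `m₀ := max m₀ 1`, `γ₁ := min` — triangle inequality under `filter_upwards`.
consumes (LINE №57): `TwoSidedRepAt` ↦ all three clauses, read at `(K, ⌊K/m⌋)` (`bgRegPr`, `bgRegPr_eq`) AND at `(K+1, ⌊K/m⌋)` (`bgRegPr'`,
`bgRegPr'_eq`); `PintCauchyAt` ↦ `r′`, `c` and its inequality; the shared `Pint`, `E` cancel only jointly (neither hypothesis alone implies the stub,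
and `TwoSidedRepAt` alone is not satisfiable by `Pint := log ρ + bg` once `Pint` is a fixed definition).  WHAT THIS IS NOT: no estimate is asserted.

References: C. King, CMP 102 (1986) 649–677 [King1986] (Thm 3.4 (3.9) p.656, (3.12)–(3.13) p.657); T. Bałaban, CMP 102 (1985) 255–275
[Balaban1985UV3] ((41) p.266, (47) p.267).
-/

noncomputable section

open MeasureTheory Filter Topology
open Literature.MathematicalPhysics.QuantumFieldTheory.Balaban1983to89
open Literature.MathematicalPhysics.QuantumFieldTheory.Balaban1983to89.T3ContinuumYM3Torus
open Literature.MathematicalPhysics.QuantumFieldTheory.Balaban1983to89.T3UnitLawDensityEML (ℰp measurableE_ℰp)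
open Literature.MathematicalPhysics.QuantumFieldTheory.Balaban1983to89.T3UnitScaleTilt
open Literature.MathematicalPhysics.QuantumFieldTheory.Balaban1983to89.T3TiltDescent
open Literature.MathematicalPhysics.QuantumFieldTheory.Balaban1983to89.T3PrintedRegularMinimiser
open Literature.MathematicalPhysics.QuantumFieldTheory.Balaban1983to89.T3LogComparisonSocket
open Literature.MathematicalPhysics.QuantumFieldTheory.Balaban1983to89.Missing

namespace Summit.QuantumFields.YangMills.Theorems.LogComparisonSocket

/-- **THE SOCKET THEOREM — `stub_logComparisonRegPr` ⇐ (R1) TWO-SIDED REPRESENTATION ∧ (R2) PINT CUT-OFF-CAUCHY, for shared explicit data.**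
Given families of interaction data `Pint F γ ε₀ b₀ p₀`, `E …`, `Rm …` (to be instantiated by the pinned (41)-data), if for every admissible block size
(R1) below a regularity threshold `ε₁` and a coupling threshold `γ₁(ε₀, b₀, p₀)` every family satisfies `TwoSidedRepAt`, and (R2) below thresholds of the
same shape and for free fractions `m ≥ m₀(ε₀)` every family satisfies `PintCauchyAt` for the SAME `Pint`, then the registered text of the stub holds
(verbatim): `κ_K := c_K − E (K+1) ⌊K/m⌋ + E K ⌊K/m⌋`, `r_K := Rm (K+1) ⌊K/m⌋ + Rm K ⌊K/m⌋ + r′_K`.  consumes: every clause of both schemas.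
[cite: King1986, Thm 3.4 (3.9) p.656] -/
theorem logComparisonRegPr_of_rep_of_cauchy
    (Pint : (F : T3Family) → (γ ε₀ b₀ p₀ : ℝ) → (K n : ℕ) → GaugeField (F.P n) 0 (Matrix.specialUnitaryGroup (Fin 2) ℂ) → ℝ)
    (E Rm : (F : T3Family) → (γ ε₀ b₀ p₀ : ℝ) → ℕ → ℕ → ℝ)
    (hrep : ∀ (L : ℕ), Odd L → 1 < L →
      ∃ ε₁ : ℝ, 0 < ε₁ ∧ ∀ (ε₀ : ℝ), 0 < ε₀ → ε₀ ≤ ε₁ → ∀ (b₀ p₀ : ℝ), 0 < b₀ → 2 < p₀ →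
        ∃ γ₁ : ℝ, 0 < γ₁ ∧ ∀ (F : T3Family) (γ : ℝ), F.L = L → 0 < γ → γ ≤ γ₁ →
          TwoSidedRepAt F γ b₀ p₀ ε₀ (Pint F γ ε₀ b₀ p₀) (E F γ ε₀ b₀ p₀) (Rm F γ ε₀ b₀ p₀))
    (hcauchy : ∀ (L : ℕ), Odd L → 1 < L →
      ∃ ε₁ : ℝ, 0 < ε₁ ∧ ∀ (ε₀ : ℝ), 0 < ε₀ → ε₀ ≤ ε₁ → ∃ m₀ : ℕ, ∀ (m : ℕ), m₀ ≤ m → ∀ (b₀ p₀ : ℝ), 0 < b₀ → 2 < p₀ →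
        ∃ γ₁ : ℝ, 0 < γ₁ ∧ ∀ (F : T3Family) (γ : ℝ), F.L = L → 0 < γ → γ ≤ γ₁ →
          PintCauchyAt F γ b₀ p₀ m (Pint F γ ε₀ b₀ p₀)) :
    ∀ (L : ℕ), Odd L → 1 < L →
      ∃ ε₁ : ℝ, 0 < ε₁ ∧ ∀ (ε₀ : ℝ), 0 < ε₀ → ε₀ ≤ ε₁ → ∃ m₀ : ℕ, ∀ (m : ℕ), m₀ ≤ m → ∀ (b₀ p₀ : ℝ), 0 < b₀ → 2 < p₀ →
        ∃ γ₁ : ℝ, 0 < γ₁ ∧ ∀ (F : T3Family) (γ : ℝ), F.L = L → 0 < γ → γ ≤ γ₁ →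
          ∃ (r κ : ℕ → ℝ), Summable r ∧ (∀ K, 0 ≤ r K) ∧
            ∀ K, ∀ᵐ V ∂fieldMeasure (F.P (K / m)) 0 (Matrix.specialUnitaryGroup (Fin 2) ℂ),
              PlaqSmall (θBal F.L γ b₀ p₀ (K / m)) V →
                0 < heightDensity F γ (Nat.div_le_self K m) (histGood F ℰp (θBal F.L γ b₀ p₀) K (K / m)) V →
                0 < heightDensity F γ ((Nat.div_le_self K m).trans (Nat.le_succ K))
                      (histGood F ℰp (θBal F.L γ b₀ p₀) (K + 1) (K / m)) V →
                  |(Real.log (heightDensity F γ ((Nat.div_le_self K m).trans (Nat.le_succ K))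
                        (histGood F ℰp (θBal F.L γ b₀ p₀) (K + 1) (K / m)) V) + bgRegPr' F γ m ε₀ K V) -
                    (Real.log (heightDensity F γ (Nat.div_le_self K m) (histGood F ℰp (θBal F.L γ b₀ p₀) K (K / m)) V) + bgRegPr F γ m ε₀ K V) -
                      κ K| ≤ r K := by
  intro L hLo hL
  obtain ⟨ε₁, hε₁, h1⟩ := hrep L hLo hL
  obtain ⟨ε₁', hε₁', h2⟩ := hcauchy L hLo hL
  refine ⟨min ε₁ ε₁', lt_min hε₁ hε₁', fun ε₀ hε₀ hε₀le => ?_⟩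
  obtain ⟨m₀, hm₀⟩ := h2 ε₀ hε₀ (hε₀le.trans (min_le_right _ _))
  refine ⟨max m₀ 1, fun m hm b₀ p₀ hb hp => ?_⟩
  have hmpos : 0 < m := Nat.lt_of_lt_of_le Nat.one_pos ((le_max_right _ _).trans hm)
  obtain ⟨γa, hγa, ha⟩ := h1 ε₀ hε₀ (hε₀le.trans (min_le_left _ _)) b₀ p₀ hb hp
  obtain ⟨γb, hγb, hb'⟩ := hm₀ m ((le_max_left _ _).trans hm) b₀ p₀ hb hp
  refine ⟨min γa γb, lt_min hγa hγb, fun F γ hFL hγ hγ₁ => ?_⟩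
  obtain ⟨hRm0, hRsum, hR⟩ := ha F γ hFL hγ (hγ₁.trans (min_le_left _ _))
  obtain ⟨r', c, hr', hr'0, hC⟩ := hb' F γ hFL hγ (hγ₁.trans (min_le_right _ _))
  have hsum : Summable fun K : ℕ => Rm F γ ε₀ b₀ p₀ (K + 1) (K / m) + Rm F γ ε₀ b₀ p₀ K (K / m) + r' K := by
    have h := (hRsum m hmpos).add hr'
    refine h.congr fun K => ?_
    ring
  refine ⟨fun K => Rm F γ ε₀ b₀ p₀ (K + 1) (K / m) + Rm F γ ε₀ b₀ p₀ K (K / m) + r' K,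
    fun K => c K - E F γ ε₀ b₀ p₀ (K + 1) (K / m) + E F γ ε₀ b₀ p₀ K (K / m),
    hsum, fun K => add_nonneg (add_nonneg (hRm0 _ _) (hRm0 _ _)) (hr'0 K), fun K => ?_⟩
  filter_upwards [hR K (K / m) (Nat.div_le_self K m), hR (K + 1) (K / m) ((Nat.div_le_self K m).trans (Nat.le_succ K)), hC K]
    with V hK hK1 hc hs h0 h0'
  -- triangle inequality: x − y − (c − E′ + E) = (x − P′ + E′) − (y − P + E) + (P′ − P − c)
  have hy := hK hs h0
  have hx := hK1 hs h0'
  have hPc := hc hs h0 h0'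
  have key : ∀ x y P₀ P₁ E₀ E₁ c₀ : ℝ, x - y - (c₀ - E₁ + E₀) = (x - P₁ + E₁) - (y - P₀ + E₀) + (P₁ - P₀ - c₀) := by
    intros
    ring
  rw [bgRegPr'_eq, bgRegPr_eq, key _ _ (Pint F γ ε₀ b₀ p₀ K (K / m) V) (Pint F γ ε₀ b₀ p₀ (K + 1) (K / m) V)
    (E F γ ε₀ b₀ p₀ K (K / m)) (E F γ ε₀ b₀ p₀ (K + 1) (K / m)) (c K)]
  exact (abs_add_le _ _).trans (add_le_add ((abs_sub _ _).trans (add_le_add hx hy)) hPc)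

/-! ## §2 The same bookkeeping PER FAMILY, and for data delivered under an existential (the shape of the v5 re-cut)

The registered re-cut of record (owner ruling g15-№1 (4), 2026-08-26T14:06Z) delivers the interaction data as `∃ D : AlphaDataT3 F γ, IsLocal D ∧
TermSize D ∧ … ∧ RepAtHeights D b₀ p₀ ε₀` (stub `stub_alphaOfLane` fed by `stub_laneInputsT3`) and the comparison as `∀ D, IsLocal D → TermSize D →
RepAtHeights D b₀ p₀ ε₀ → CauchyAtHeights D m` (stub `stub_cauchyOfLocalRep`), where `RepAtHeights D b₀ p₀ ε₀ := TwoSidedRepAt F γ b₀ p₀ ε₀ D.PintH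
D.EcstH D.RmH` and `CauchyAtHeights D m := PintCauchyAt F γ b₀ p₀ m D.PintH` (interface `T3AlphaInputsAC`, typer skeleton d4405079030c201b §5).  So
the composition needs the socket theorem for ONE family (below, `stubBody_of_rep_of_cauchy`) and an ∃-data wrapper (`logComparisonRegPr_of_exists_data`)
over an ARBITRARY data type `Δ F γ` with readings `pint/e/rm` and an arbitrary side condition `Good` (to be `IsLocal ∧ TermSize`) — so that it applies
to the interface the day it lands, by instantiation, whatever its final field list.  THE QUANTIFIER CONTRACT it fixes (the only freedom the v5 texts
have if `stub_logComparisonRegPr` is to follow by instantiation): thresholds in the order `∀ L, ∃ ε₁, ∀ ε₀ ≤ ε₁, [∃ m₀, ∀ m ≥ m₀,] ∀ b₀ p₀, ∃ γ₁,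
∀ F γ ≤ γ₁`, the data `D` innermost (`∃ D` after `F γ`; `D` may depend on `ε₀ b₀ p₀`), and `m₀ = m₀(L, ε₀)` BEFORE `b₀ p₀ F γ D` — in particular the
exponents that decide `m₀` (S-B: `m > 1 + β/γ′`) must be functions of `L` (through `Good`'s constants), never fields of `D`. -/

/-- **THE SOCKET FOR ONE FAMILY**: `TwoSidedRepAt F γ b₀ p₀ ε₀ Pint E Rm` ∧ `PintCauchyAt F γ b₀ p₀ m Pint` (`m ≥ 1`) ⇒ the body of the registered
stub for `(F, γ, m, b₀, p₀, ε₀)`: summable `r ≥ 0`, constants `κ`, and the a.e. two-run comparison of the fluctuation parts with `bgRegPr`/`bgRegPr'`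
(`κ_K := c_K − E (K+1) n + E K n`, `r_K := Rm (K+1) n + Rm K n + r′_K`, `n = ⌊K/m⌋`). [cite: King1986, Thm 3.4 (3.9) p.656] -/
theorem stubBody_of_rep_of_cauchy (F : T3Family) (γ b₀ p₀ ε₀ : ℝ) {m : ℕ} (hm : 0 < m)
    (Pint : (K n : ℕ) → GaugeField (F.P n) 0 (Matrix.specialUnitaryGroup (Fin 2) ℂ) → ℝ) (E Rm : ℕ → ℕ → ℝ)
    (hrep : TwoSidedRepAt F γ b₀ p₀ ε₀ Pint E Rm) (hcauchy : PintCauchyAt F γ b₀ p₀ m Pint) :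
    ∃ (r κ : ℕ → ℝ), Summable r ∧ (∀ K, 0 ≤ r K) ∧
      ∀ K, ∀ᵐ V ∂fieldMeasure (F.P (K / m)) 0 (Matrix.specialUnitaryGroup (Fin 2) ℂ),
        PlaqSmall (θBal F.L γ b₀ p₀ (K / m)) V →
          0 < heightDensity F γ (Nat.div_le_self K m) (histGood F ℰp (θBal F.L γ b₀ p₀) K (K / m)) V →
          0 < heightDensity F γ ((Nat.div_le_self K m).trans (Nat.le_succ K))
                (histGood F ℰp (θBal F.L γ b₀ p₀) (K + 1) (K / m)) V →
            |(Real.log (heightDensity F γ ((Nat.div_le_self K m).trans (Nat.le_succ K))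
                  (histGood F ℰp (θBal F.L γ b₀ p₀) (K + 1) (K / m)) V) + bgRegPr' F γ m ε₀ K V) -
              (Real.log (heightDensity F γ (Nat.div_le_self K m) (histGood F ℰp (θBal F.L γ b₀ p₀) K (K / m)) V) + bgRegPr F γ m ε₀ K V) -
                κ K| ≤ r K := by
  obtain ⟨hRm0, hRsum, hR⟩ := hrep
  obtain ⟨r', c, hr', hr'0, hC⟩ := hcauchy
  have hsum : Summable fun K : ℕ => Rm (K + 1) (K / m) + Rm K (K / m) + r' K := by
    have h := (hRsum m hm).add hr'
    refine h.congr fun K => ?_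
    ring
  refine ⟨fun K => Rm (K + 1) (K / m) + Rm K (K / m) + r' K, fun K => c K - E (K + 1) (K / m) + E K (K / m),
    hsum, fun K => add_nonneg (add_nonneg (hRm0 _ _) (hRm0 _ _)) (hr'0 K), fun K => ?_⟩
  filter_upwards [hR K (K / m) (Nat.div_le_self K m), hR (K + 1) (K / m) ((Nat.div_le_self K m).trans (Nat.le_succ K)), hC K]
    with V hK hK1 hc hs h0 h0'
  have hy := hK hs h0
  have hx := hK1 hs h0'
  have hPc := hc hs h0 h0'
  have key : ∀ x y P₀ P₁ E₀ E₁ c₀ : ℝ, x - y - (c₀ - E₁ + E₀) = (x - P₁ + E₁) - (y - P₀ + E₀) + (P₁ - P₀ - c₀) := by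
    intros
    ring
  rw [bgRegPr'_eq, bgRegPr_eq, key _ _ (Pint K (K / m) V) (Pint (K + 1) (K / m) V) (E K (K / m)) (E (K + 1) (K / m)) (c K)]
  exact (abs_add_le _ _).trans (add_le_add ((abs_sub _ _).trans (add_le_add hx hy)) hPc)

/-- **`stub_logComparisonRegPr` FROM DATA DELIVERED UNDER AN EXISTENTIAL** (the v5 re-cut's shape): for any data type `Δ F γ` with readings
`pint D : (K n) → (F.P n)₀-fields → ℝ`, `e D, rm D : ℕ → ℕ → ℝ` and any side condition `Good D ε₀ b₀ p₀` (to be `IsLocal D ∧ TermSize D`), if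
(R) below thresholds `ε₁(L)`, `γ₁(L, ε₀, b₀, p₀)` every family carries SOME good datum satisfying `TwoSidedRepAt`, and (C) below thresholds of the
same shape with `m₀(L, ε₀)`, EVERY good datum satisfying `TwoSidedRepAt` satisfies `PintCauchyAt`, then the registered 888-character text holds
(verbatim).  Instantiation of record: `Δ := AlphaDataT3`, `pint := PintH`, `e := EcstH`, `rm := RmH`. [cite: King1986, Thm 3.4 (3.9) p.656] -/
theorem logComparisonRegPr_of_exists_data {Δ : T3Family → ℝ → Type*}
    (pint : ∀ {F : T3Family} {γ : ℝ}, Δ F γ → (K n : ℕ) → GaugeField (F.P n) 0 (Matrix.specialUnitaryGroup (Fin 2) ℂ) → ℝ)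
    (e rm : ∀ {F : T3Family} {γ : ℝ}, Δ F γ → ℕ → ℕ → ℝ)
    (Good : ∀ {F : T3Family} {γ : ℝ}, Δ F γ → ℝ → ℝ → ℝ → Prop)
    (hR : ∀ (L : ℕ), Odd L → 1 < L →
      ∃ ε₁ : ℝ, 0 < ε₁ ∧ ∀ (ε₀ : ℝ), 0 < ε₀ → ε₀ ≤ ε₁ → ∀ (b₀ p₀ : ℝ), 0 < b₀ → 2 < p₀ →
        ∃ γ₁ : ℝ, 0 < γ₁ ∧ ∀ (F : T3Family) (γ : ℝ), F.L = L → 0 < γ → γ ≤ γ₁ →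
          ∃ D : Δ F γ, Good D ε₀ b₀ p₀ ∧ TwoSidedRepAt F γ b₀ p₀ ε₀ (pint D) (e D) (rm D))
    (hC : ∀ (L : ℕ), Odd L → 1 < L →
      ∃ ε₁ : ℝ, 0 < ε₁ ∧ ∀ (ε₀ : ℝ), 0 < ε₀ → ε₀ ≤ ε₁ → ∃ m₀ : ℕ, ∀ (m : ℕ), m₀ ≤ m → ∀ (b₀ p₀ : ℝ), 0 < b₀ → 2 < p₀ →
        ∃ γ₁ : ℝ, 0 < γ₁ ∧ ∀ (F : T3Family) (γ : ℝ), F.L = L → 0 < γ → γ ≤ γ₁ →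
          ∀ D : Δ F γ, Good D ε₀ b₀ p₀ → TwoSidedRepAt F γ b₀ p₀ ε₀ (pint D) (e D) (rm D) → PintCauchyAt F γ b₀ p₀ m (pint D)) :
    ∀ (L : ℕ), Odd L → 1 < L →
      ∃ ε₁ : ℝ, 0 < ε₁ ∧ ∀ (ε₀ : ℝ), 0 < ε₀ → ε₀ ≤ ε₁ → ∃ m₀ : ℕ, ∀ (m : ℕ), m₀ ≤ m → ∀ (b₀ p₀ : ℝ), 0 < b₀ → 2 < p₀ →
        ∃ γ₁ : ℝ, 0 < γ₁ ∧ ∀ (F : T3Family) (γ : ℝ), F.L = L → 0 < γ → γ ≤ γ₁ →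
          ∃ (r κ : ℕ → ℝ), Summable r ∧ (∀ K, 0 ≤ r K) ∧
            ∀ K, ∀ᵐ V ∂fieldMeasure (F.P (K / m)) 0 (Matrix.specialUnitaryGroup (Fin 2) ℂ),
              PlaqSmall (θBal F.L γ b₀ p₀ (K / m)) V →
                0 < heightDensity F γ (Nat.div_le_self K m) (histGood F ℰp (θBal F.L γ b₀ p₀) K (K / m)) V →
                0 < heightDensity F γ ((Nat.div_le_self K m).trans (Nat.le_succ K))
                      (histGood F ℰp (θBal F.L γ b₀ p₀) (K + 1) (K / m)) V →
                  |(Real.log (heightDensity F γ ((Nat.div_le_self K m).trans (Nat.le_succ K))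
                        (histGood F ℰp (θBal F.L γ b₀ p₀) (K + 1) (K / m)) V) + bgRegPr' F γ m ε₀ K V) -
                    (Real.log (heightDensity F γ (Nat.div_le_self K m) (histGood F ℰp (θBal F.L γ b₀ p₀) K (K / m)) V) + bgRegPr F γ m ε₀ K V) -
                      κ K| ≤ r K := by
  intro L hLo hL
  obtain ⟨ε₁, hε₁, h1⟩ := hR L hLo hL
  obtain ⟨ε₁', hε₁', h2⟩ := hC L hLo hL
  refine ⟨min ε₁ ε₁', lt_min hε₁ hε₁', fun ε₀ hε₀ hε₀le => ?_⟩
  obtain ⟨m₀, hm₀⟩ := h2 ε₀ hε₀ (hε₀le.trans (min_le_right _ _))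
  refine ⟨max m₀ 1, fun m hm b₀ p₀ hb hp => ?_⟩
  have hmpos : 0 < m := Nat.lt_of_lt_of_le Nat.one_pos ((le_max_right _ _).trans hm)
  obtain ⟨γa, hγa, ha⟩ := h1 ε₀ hε₀ (hε₀le.trans (min_le_left _ _)) b₀ p₀ hb hp
  obtain ⟨γb, hγb, hb'⟩ := hm₀ m ((le_max_left _ _).trans hm) b₀ p₀ hb hp
  refine ⟨min γa γb, lt_min hγa hγb, fun F γ hFL hγ hγ₁ => ?_⟩
  obtain ⟨D, hG, hRep⟩ := ha F γ hFL hγ (hγ₁.trans (min_le_left _ _))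
  exact stubBody_of_rep_of_cauchy F γ b₀ p₀ ε₀ hmpos (pint D) (e D) (rm D) hRep
    (hb' F γ hFL hγ (hγ₁.trans (min_le_right _ _)) D hG hRep)

end Summit.QuantumFields.YangMills.Theorems.LogComparisonSocket

end
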